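import HarnessLib
import Summits.HodgeConjecture.HodgeConjecture.Cruxes.H413.Lines.K2_E3_EllipticInputs
import Literature.NumberTheory.Automorphic.LocalIrrepAdmissible
import Summits.HodgeConjecture.HodgeConjecture.Theorems.K2E3CharLocConstOnRegularSetOfLocal
import Summits.HodgeConjecture.HodgeConjecture.Theorems.K2E3CharLocIntOfLocal
import Summits.HodgeConjecture.HodgeConjecture.Theorems.K2E3CharLocBddOfLocal
import Summits.HodgeConjecture.HodgeConjecture.Theorems.K2E3NormalizedCharBddNearSemisimpleDescent
import Summits.HodgeConjecture.HodgeConjecture.Theorems.K2E3OrbitClosureContainsSemisimple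
import Summits.HodgeConjecture.HodgeConjecture.Theorems.K2E3CayleySliceConjugatesNhds
import Summits.HodgeConjecture.HodgeConjecture.Theorems.K2E3CharLocConstNearRegular
import Summits.HodgeConjecture.HodgeConjecture.Theorems.K2E3CharLocIntNearSemisimpleSupercuspidalOfTruncated
import Summits.HodgeConjecture.HodgeConjecture.Theorems.K2E3NormalizedCharBddOnCayleySliceOfLieCoreFixed
import Summits.HodgeConjecture.HodgeConjecture.Theorems.K2E3GL2NilpotentFourierRegularOfStructure
import Summits.HodgeConjecture.HodgeConjecture.Theorems.K2E3LocalIrrepAdmissibleQuasiSplit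
import Summits.HodgeConjecture.HodgeConjecture.Theorems.K2E3LocalIrrepAdmissibleAnyKernel
import Summits.HodgeConjecture.HodgeConjecture.Theorems.K2E3CharLocIntIrreduciblePrincipalSeries
import Summits.HodgeConjecture.HodgeConjecture.Theorems.K2E3CharLocIntSteinbergClasses
import Summits.HodgeConjecture.HodgeConjecture.Theorems.K2E3CharLocIntNearModelTransport
import Summits.HodgeConjecture.HodgeConjecture.Theorems.F0P3bNonsplitIdentification
import Summits.HodgeConjecture.HodgeConjecture.Theorems.K2E3LocalIrrepCuspidalOrPrincipalThree
import Summits.HodgeConjecture.HodgeConjecture.Theorems.K2E3GL2RegularNilpotentFourier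
import Summits.HodgeConjecture.HodgeConjecture.Theorems.K2E3GL2NilpotentOneOrbitUniqueness
import Summits.HodgeConjecture.HodgeConjecture.Theorems.K2E3U2NilpotentFourierRegularOfGL2
import Summits.HodgeConjecture.HodgeConjecture.Theorems.K2E3U01NilpotentFourierRegular
import Summits.HodgeConjecture.HodgeConjecture.Theorems.K2E3GL2NmNilpotentFourierRegularOfTwistedLocal
import Summits.HodgeConjecture.HodgeConjecture.Theorems.K2E3GL3NilpotentFourierRegularOfSliceDensities
import Summits.HodgeConjecture.HodgeConjecture.Theorems.K2E3NormalizedCharBddNearSingularDescentLeTwo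
import Summits.HodgeConjecture.HodgeConjecture.Theorems.K2E3GL2TwistedRegularNilpotentFourier
import Summits.HodgeConjecture.HodgeConjecture.Theorems.K2E3GL3BorelSliceDensity
import Summits.HodgeConjecture.HodgeConjecture.Theorems.K2E3GL3ParabolicSliceDensity
import Summits.HodgeConjecture.HodgeConjecture.Theorems.K2E3GL3SupercuspidalCharLocInt
import Summits.HodgeConjecture.HodgeConjecture.Theorems.K2E3GL3ModUniformizerNonEllEstimates
import Summits.HodgeConjecture.HodgeConjecture.Theorems.K2E3CharLocIntNearSplitSupercuspidalTransport
import Literature.NumberTheory.Automorphic.AnisotropicUnitaryGroupCompactLocal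
import Summits.HodgeConjecture.HodgeConjecture.Theorems.K2E3CharLocIntNearSplitNonSupercuspidalTransport
import Summits.HodgeConjecture.HodgeConjecture.Theorems.K2E3CharLocIntNearParabolicIndOfAC
import Summits.HodgeConjecture.HodgeConjecture.Theorems.K2E3CharLocIntNearLinearCombination
import Summits.HodgeConjecture.HodgeConjecture.Theorems.K2E3GL3ParabolicKMUAbsCont
import Summits.HodgeConjecture.HodgeConjecture.Theorems.K2E3GL3BorelKMUAbsCont
import Literature.NumberTheory.Automorphic.ParabolicInductionSupercuspidalProofs
import Summits.HodgeConjecture.HodgeConjecture.Theorems.K2E3FinConjPlaceOfFinConj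
import Literature.NumberTheory.Automorphic.IrreducibleClassesConstituents
import Summits.HodgeConjecture.HodgeConjecture.Cruxes.H413.Lines.K2_E3_EllipticInputsSigs_Lie3b    -- ED. 2: PART «LIE3b» (K2E3-typ4 (g0), tree cc262bdfb6b2b155): §B head re-proves (12D-3) over (12D-3U)/(12D-3tr)/(12D-3split); imports no sig PART (no cycle)
-- import block = PART «LIE» (tree sha16 ab77c5ccccbbc4a5) import TARGETS verbatim, comments stripped; this PART does NOT import «LIE» (no socket below needs a «LIE» decl) and «LIE» does not
-- import this PART until the dealer's tie edition (K2E3-plan g4) re-ties (LBU-ge3) ∕ (12D-ge3) over the four sockets below by the `Nat.eq_or_lt_of_le` split.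

/-!
# K2_E3_EllipticInputs ∕ U12Characters — PART «LIE3» (tier 1): the `N = 3` INSTANCES and the `N ≥ 4` REMAINDERS of the two open «LIE» leaves (LBU-ge3) and (12D-ge3), hosted apart
(SAME namespace `Summit.HodgeConjecture.HodgeConjecture.Cruxes.H413.K2E3EllipticInputs.U12Characters`; new decl names; «LIE» is 83 kB and is the dealer's chain — this PART is
K2E3-typ2's own file, L4 EMIT #1 2026-09-04T14:52:25Z).

WHY (K2E3-typ2 g0, ED. 1, 2026-09-04 ≈15:2xZ; strike line L4 `stub_StCharTS`, CLOSE-OUT DAY «N ≤ 3 cut»).  The tier-0 organ `stub_EllipticInputs` instantiates (L-B_U)′ and (12-D) only at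
`N ≤ 3` (tier-0 PRICE FLAG (i)); «LIE» already pays `N ≤ 2` ★ and leaves (LBU-ge3) `sig_K2E3UNilpotentFourierRegularGeThree` («LIE» :524) and (12D-ge3)
`sig_K2E3NormalizedCharBddNearSingularDescentGeThree` («LIE» :619) OPEN, each quantified over every `N ≥ 3`.  This PART cuts both BY `N` once more so that the `N = 3` instances become NAMED,
`Fin 3`-typed leaves for the L4 fan (K2E3-p34…p37 ∕ architect K2E3-p25) and the `N ≥ 4` remainders are visibly GENERALITY (no consumer on the `stub_StCharTS` cone; count-neutral residue):
* **(LBU-3) `sig_K2E3UNilpotentFourierRegularThree`** — Harish-Chandra Thm. 4.4 ∕ §21 for the nilpotent-supported invariant distributions `J(𝒩)` on `𝔲(σ_w, H_w)`, `H ∈ M₃(L)` hermitian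
  non-degenerate (`U(3)` at a place `w ∣ v` fixed by `c`): statement = (LBU-ge3) text with the binder `(N : ℕ), 3 ≤ N →` deleted and every token `N ↦ 3` (the `subst`-image; nothing else);
* **(LBU-ge4) `sig_K2E3UNilpotentFourierRegularGeFour`** — the same text under `4 ≤ N` (single edit `3 ≤ N →` ↦ `4 ≤ N →`); OPEN XL GENERALITY, unroaded, like (LBGL-ge4) «LIE» :237;
* **(12D-3) `sig_K2E3NormalizedCharBddNearSingularDescentThree`** — Harish-Chandra's descent bound for `|D|^{1∕4}·Θ_π` near a NON-CENTRAL SINGULAR semisimple `s` of `U_3(H)(L⁺_v)`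
  (first live case `s ∼ diag(α, α, β)`, `G_s = U(2) × U(1)`; HC1999 §18): statement = (12D-ge3) text, binder deleted, `N ↦ 3` (so `cmDatum L 3 H`, `^ (3 - 1)`);
* **(12D-ge4) `sig_K2E3NormalizedCharBddNearSingularDescentGeFour`** — the same text under `4 ≤ N`; OPEN XL GENERALITY.
Statement bytes: bracket-extracted from «LIE» tree sha16 ab77c5ccccbbc4a5 by the generator `K2/K2E3-typ2/g0/mk_lie3_ed1.py` (asserts: binder occurs once; token-`N` count preserved as
`3`; (ge4) == (ge3) text up to the one edit; block prefix = «LIE»'s verbatim; 4 sorries; no `instance` ∕ `notation` ∕ `axiom`; no banned option).  The dealer's tie (LIE ED. next,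
K2E3-plan g4's chain, pre-checked in `K2/K2E3-typ2/g0/probe_lie3_tie.scratch.lean`): `intro L _ _ _ N hN; rcases Nat.eq_or_lt_of_le hN with h3 | h4; · subst h3; exact sig_…Three L;
· exact sig_…GeFour L N h4` for both leaves.  Payers conclude a socket BY NAME from `Theorems/…` (`--supports stmt-HodgeConjecture-24833 --as helper`), never importing `Lines`.
Sorries in THIS file = 3 = {(LBU-3), (LBU-ge4), (12D-ge4)} (ED. 2; ED. 1 had 4 — (12D-3) is tied over PART «LIE3b», whose (12D-3U)/(12D-3tr)/(12D-3split) sockets carry it).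

HONEST LABEL: HC_CM is proved only modulo the 7 printed citations (2 remaining named inputs: hLiu418 = stmt-HodgeConjecture-24832, h413 = stmt-HodgeConjecture-24833) until rung 0
closes; a hosted socket is a by-name debt; REL ≠ ★ ≠ BUILT.  ACCOUNTING at the dealer's tie edition: «LIE» (LBU-ge3) → REL over EXACTLY {(LBU-3), (LBU-ge4)}; (12D-ge3) → REL over EXACTLY
{(12D-3), (12D-ge4)} (E3 Lines +2: finer named currency; on the `N ≤ 3` cone the open «LIE»-side debt is then exactly {(L-A_GL), (L-A_U)′, (LBU-3), (12D-3)}).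

§ EDITIONS (this PART).  ED. 1 (K2E3-typ2 g0; generator `K2/K2E3-typ2/g0/mk_lie3_ed1.py`; source «LIE» tree sha16 ab77c5ccccbbc4a5): created.
ED. 2 (K2E3-typ2 g0; generator `mk_lie3_ed2.py`, base ED. 1 sha16 3703894af4fdc5d2): (12D-3) TIED `:= normalizedCharBddNearSingularDescentThree_of_sigs` (PART «LIE3b» ED. 1 §B head, K2E3-typ4 (g0), tree sha16 cc262bdfb6b2b155: `by_cases` on the non-split hypothesis `hns` into the (12D-3U)+(12D-3tr) model road and the (12D-3split) letter — the (12D-3) content now lives in those THREE LIE3b sockets); statement bytes of all four sockets unchanged; sorries 4 → 3 = {(LBU-3), (LBU-ge4), (12D-ge4)}.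
-/

noncomputable section

open NumberField IsDedekindDomain MeasureTheory
open scoped Matrix MatrixGroups Valued NNReal
open Literature.NumberTheory.Rogawski1990 Literature.NumberTheory.Automorphic Literature.NumberTheory.Automorphic.UnitaryGroup
open Literature.NumberTheory.Automorphic.UnitaryGroup.CotangentForms Literature.NumberTheory.GaloisRepresentations
open Literature.NumberTheory.Automorphic.Arthur2013.Leaves.TECR
open Summit.HodgeConjecture.HodgeConjecture.Cruxes.H413.F0P3cStCharTSPaydown

namespace Summit.HodgeConjecture.HodgeConjecture.Cruxes.H413.K2E3EllipticInputs.U12Characters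

/-! ## §L3 (ED. 1) — (LBU-ge3) and (12D-ge3) of PART «LIE» cut BY `N`: the `N = 3` instances and the `N ≥ 4` remainders -/

set_option maxHeartbeats 1600000 in
set_option synthInstance.maxHeartbeats 400000 in
open scoped Classical in
open MeasureTheory.Measure Filter Topology Polynomial Literature.NumberTheory.GaloisRepresentations.IsNonarchimedeanLocalField Summit.HodgeConjecture.HodgeConjecture.Cruxes.H413.K2E3LieUnitary in
/-- **LEAF (LBU-3) `sig_K2E3UNilpotentFourierRegularThree`** — (L-B_U)′ AT `N = 3`: Harish-Chandra Thm. 4.4 ∕ §21 for `J(𝒩)` on `𝔲(σ_w,H_w)`, `H ∈ M₃(L)` — every `U(σ_w,H_w)`-invariant, nilpotent-supported distribution `T` on the Lie algebra has Fourier transform a locally integrable function `Fn`,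
locally constant on the regular set and `|D|^{1∕4}`-bounded on compacta (= (LBU-ge3) «LIE» :524 with `N := 3`; the ONE load-bearing instance of that leaf on the `stub_StCharTS` cone; size XL; no road in tree yet —
the `GL₃` twin (LBGL-ge3) at `N = 3` is ★ via slice densities «J(𝒩)(𝔤𝔩₃) = ℂδ₀ ⊕ ℂΛ_E ⊕ ℂΛ_J» p857476∕p857562, a candidate template through the `σ_w`-fixed-point structure of the three nilpotent `U(3)`-orbit types). [cite: HarishChandra1999AdmissibleDistributions, Thm. 4.4 p. 11, §21 p. 87]
ED. 1 (K2E3-typ2 g0, 2026-09-04): HOSTED LEAF — statement bytes = the cut described in the module docstring, from «LIE» tree sha16 ab77c5ccccbbc4a5 (generator `mk_lie3_ed1.py`).  OPEN (payer files `Theorems/…lean --supports stmt-HodgeConjecture-24833 --as helper`, never importing `Lines`).  STATE: OPEN. -/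
theorem sig_K2E3UNilpotentFourierRegularThree :
    ∀ (L : Type) [Field L] [NumberField L] [IsCMField L] (H : Matrix (Fin 3) (Fin 3) L),
      (H.map (cmConjRingHom L))ᵀ = H → H.det ≠ 0 →
      ∀ (v : HeightOneSpectrum (𝓞 ↥(maximalRealSubfield L))) (w : UnitaryGroup.PlacesOver L v) (hw : IsCMField.complexConj L • w.1 = w.1)
      (ψ : AddChar (w.1.adicCompletion L) Circle), ψ.IsContinuousNontrivial →
      (∃ a : w.1.adicCompletion L, galAdicCompletionMap (L := L) (IsCMField.complexConj L) hw a = a ∧ ψ a ≠ 1) →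
      ∀ [MeasurableSpace ↥(lieOfForm (galAdicCompletionMap (L := L) (IsCMField.complexConj L) hw) (UnitaryGroup.placeForm H w.1))]
        [BorelSpace ↥(lieOfForm (galAdicCompletionMap (L := L) (IsCMField.complexConj L) hw) (UnitaryGroup.placeForm H w.1))]
        (μ𝔤 : Measure ↥(lieOfForm (galAdicCompletionMap (L := L) (IsCMField.complexConj L) hw) (UnitaryGroup.placeForm H w.1))) [μ𝔤.IsAddHaarMeasure],
      ∀ T : (↥(lieOfForm (galAdicCompletionMap (L := L) (IsCMField.complexConj L) hw) (UnitaryGroup.placeForm H w.1)) → ℂ) → ℂ,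
        ((∀ f₁ f₂ : ↥(lieOfForm (galAdicCompletionMap (L := L) (IsCMField.complexConj L) hw) (UnitaryGroup.placeForm H w.1)) → ℂ, IsLocSmooth f₁ → IsLocSmooth f₂ → T (f₁ + f₂) = T f₁ + T f₂) ∧
         (∀ (a : ℂ) (f : ↥(lieOfForm (galAdicCompletionMap (L := L) (IsCMField.complexConj L) hw) (UnitaryGroup.placeForm H w.1)) → ℂ), IsLocSmooth f → T (a • f) = a * T f) ∧
         (∀ (x : ↥(unitaryGroupOfForm (galAdicCompletionMap (L := L) (IsCMField.complexConj L) hw) (UnitaryGroup.placeForm H w.1))) (f : ↥(lieOfForm (galAdicCompletionMap (L := L) (IsCMField.complexConj L) hw) (UnitaryGroup.placeForm H w.1)) → ℂ), IsLocSmooth f →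
            T (fun X => f ⟨((x : GL (Fin 3) (w.1.adicCompletion L)) : Matrix (Fin 3) (Fin 3) (w.1.adicCompletion L)) * X.1 * (((x : GL (Fin 3) (w.1.adicCompletion L))⁻¹ : GL (Fin 3) (w.1.adicCompletion L)) : Matrix (Fin 3) (Fin 3) (w.1.adicCompletion L)),
              conj_mem_lieOfForm x.2 X.2⟩) = T f) ∧
         (∀ f : ↥(lieOfForm (galAdicCompletionMap (L := L) (IsCMField.complexConj L) hw) (UnitaryGroup.placeForm H w.1)) → ℂ, IsLocSmooth f → (∀ X ∈ tsupport f, ¬ IsNilpotent X.1) → T f = 0)) →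
        ∃ Fn : ↥(lieOfForm (galAdicCompletionMap (L := L) (IsCMField.complexConj L) hw) (UnitaryGroup.placeForm H w.1)) → ℂ, LocallyIntegrable Fn μ𝔤 ∧
          (∀ f : ↥(lieOfForm (galAdicCompletionMap (L := L) (IsCMField.complexConj L) hw) (UnitaryGroup.placeForm H w.1)) → ℂ, IsLocSmooth f → T (lieFourier (galAdicCompletionMap (L := L) (IsCMField.complexConj L) hw) (UnitaryGroup.placeForm H w.1) (fun x : w.1.adicCompletion L => ((ψ x : Circle) : ℂ)) μ𝔤 f) = ∫ X, f X * Fn X ∂μ𝔤) ∧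
          (∀ X : ↥(lieOfForm (galAdicCompletionMap (L := L) (IsCMField.complexConj L) hw) (UnitaryGroup.placeForm H w.1)), IsUnit X.1.charpoly.discr → ∀ᶠ Y in 𝓝 X, Fn Y = Fn X) ∧
          (∀ C : Set ↥(lieOfForm (galAdicCompletionMap (L := L) (IsCMField.complexConj L) hw) (UnitaryGroup.placeForm H w.1)), IsCompact C → ∃ B : ℝ, ∀ X ∈ C,
              ((NNReal.sqrt (NNReal.sqrt (normAbs (w.1.adicCompletion L) X.1.charpoly.discr)) : ℝ≥0) : ℝ) * ‖Fn X‖ ≤ B) := by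
  sorry

set_option maxHeartbeats 1600000 in
set_option synthInstance.maxHeartbeats 400000 in
open scoped Classical in
open MeasureTheory.Measure Filter Topology Polynomial Literature.NumberTheory.GaloisRepresentations.IsNonarchimedeanLocalField Summit.HodgeConjecture.HodgeConjecture.Cruxes.H413.K2E3LieUnitary in
/-- **LEAF (LBU-ge4) `sig_K2E3UNilpotentFourierRegularGeFour`** — (L-B_U)′ FOR `N ≥ 4` (= (LBU-ge3) «LIE» :524 text under `4 ≤ N`, single edit; size XL; NO kernel road; GENERALITY: the tier-0 organ instantiates (L-B_U)′ only at `N ≤ 3`, so this remainder has no consumer on the `stub_StCharTS` cone; count-neutral residue). [cite: HarishChandra1999AdmissibleDistributions, Thm. 4.4 p. 11, §21 p. 87]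
ED. 1 (K2E3-typ2 g0, 2026-09-04): HOSTED LEAF — statement bytes = the cut described in the module docstring, from «LIE» tree sha16 ab77c5ccccbbc4a5 (generator `mk_lie3_ed1.py`).  OPEN (payer files `Theorems/…lean --supports stmt-HodgeConjecture-24833 --as helper`, never importing `Lines`).  STATE: OPEN. -/
theorem sig_K2E3UNilpotentFourierRegularGeFour :
    ∀ (L : Type) [Field L] [NumberField L] [IsCMField L] (N : ℕ), 4 ≤ N → ∀ (H : Matrix (Fin N) (Fin N) L),
      (H.map (cmConjRingHom L))ᵀ = H → H.det ≠ 0 →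
      ∀ (v : HeightOneSpectrum (𝓞 ↥(maximalRealSubfield L))) (w : UnitaryGroup.PlacesOver L v) (hw : IsCMField.complexConj L • w.1 = w.1)
      (ψ : AddChar (w.1.adicCompletion L) Circle), ψ.IsContinuousNontrivial →
      (∃ a : w.1.adicCompletion L, galAdicCompletionMap (L := L) (IsCMField.complexConj L) hw a = a ∧ ψ a ≠ 1) →
      ∀ [MeasurableSpace ↥(lieOfForm (galAdicCompletionMap (L := L) (IsCMField.complexConj L) hw) (UnitaryGroup.placeForm H w.1))]
        [BorelSpace ↥(lieOfForm (galAdicCompletionMap (L := L) (IsCMField.complexConj L) hw) (UnitaryGroup.placeForm H w.1))]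
        (μ𝔤 : Measure ↥(lieOfForm (galAdicCompletionMap (L := L) (IsCMField.complexConj L) hw) (UnitaryGroup.placeForm H w.1))) [μ𝔤.IsAddHaarMeasure],
      ∀ T : (↥(lieOfForm (galAdicCompletionMap (L := L) (IsCMField.complexConj L) hw) (UnitaryGroup.placeForm H w.1)) → ℂ) → ℂ,
        ((∀ f₁ f₂ : ↥(lieOfForm (galAdicCompletionMap (L := L) (IsCMField.complexConj L) hw) (UnitaryGroup.placeForm H w.1)) → ℂ, IsLocSmooth f₁ → IsLocSmooth f₂ → T (f₁ + f₂) = T f₁ + T f₂) ∧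
         (∀ (a : ℂ) (f : ↥(lieOfForm (galAdicCompletionMap (L := L) (IsCMField.complexConj L) hw) (UnitaryGroup.placeForm H w.1)) → ℂ), IsLocSmooth f → T (a • f) = a * T f) ∧
         (∀ (x : ↥(unitaryGroupOfForm (galAdicCompletionMap (L := L) (IsCMField.complexConj L) hw) (UnitaryGroup.placeForm H w.1))) (f : ↥(lieOfForm (galAdicCompletionMap (L := L) (IsCMField.complexConj L) hw) (UnitaryGroup.placeForm H w.1)) → ℂ), IsLocSmooth f →
            T (fun X => f ⟨((x : GL (Fin N) (w.1.adicCompletion L)) : Matrix (Fin N) (Fin N) (w.1.adicCompletion L)) * X.1 * (((x : GL (Fin N) (w.1.adicCompletion L))⁻¹ : GL (Fin N) (w.1.adicCompletion L)) : Matrix (Fin N) (Fin N) (w.1.adicCompletion L)),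
              conj_mem_lieOfForm x.2 X.2⟩) = T f) ∧
         (∀ f : ↥(lieOfForm (galAdicCompletionMap (L := L) (IsCMField.complexConj L) hw) (UnitaryGroup.placeForm H w.1)) → ℂ, IsLocSmooth f → (∀ X ∈ tsupport f, ¬ IsNilpotent X.1) → T f = 0)) →
        ∃ Fn : ↥(lieOfForm (galAdicCompletionMap (L := L) (IsCMField.complexConj L) hw) (UnitaryGroup.placeForm H w.1)) → ℂ, LocallyIntegrable Fn μ𝔤 ∧
          (∀ f : ↥(lieOfForm (galAdicCompletionMap (L := L) (IsCMField.complexConj L) hw) (UnitaryGroup.placeForm H w.1)) → ℂ, IsLocSmooth f → T (lieFourier (galAdicCompletionMap (L := L) (IsCMField.complexConj L) hw) (UnitaryGroup.placeForm H w.1) (fun x : w.1.adicCompletion L => ((ψ x : Circle) : ℂ)) μ𝔤 f) = ∫ X, f X * Fn X ∂μ𝔤) ∧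
          (∀ X : ↥(lieOfForm (galAdicCompletionMap (L := L) (IsCMField.complexConj L) hw) (UnitaryGroup.placeForm H w.1)), IsUnit X.1.charpoly.discr → ∀ᶠ Y in 𝓝 X, Fn Y = Fn X) ∧
          (∀ C : Set ↥(lieOfForm (galAdicCompletionMap (L := L) (IsCMField.complexConj L) hw) (UnitaryGroup.placeForm H w.1)), IsCompact C → ∃ B : ℝ, ∀ X ∈ C,
              ((NNReal.sqrt (NNReal.sqrt (normAbs (w.1.adicCompletion L) X.1.charpoly.discr)) : ℝ≥0) : ℝ) * ‖Fn X‖ ≤ B) := by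
  sorry

set_option maxHeartbeats 1600000 in
set_option synthInstance.maxHeartbeats 400000 in
open scoped Classical in
open MeasureTheory.Measure Filter Topology Polynomial Literature.NumberTheory.GaloisRepresentations.IsNonarchimedeanLocalField Summit.HodgeConjecture.HodgeConjecture.Cruxes.H413.K2E3LieUnitary in
/-- **LEAF (12D-3) `sig_K2E3NormalizedCharBddNearSingularDescentThree`** — (12-D) AT `N = 3`: Harish-Chandra's descent near a NON-CENTRAL SINGULAR semisimple `s ∈ U_3(H)(L⁺_v)` — given a locally integrable, regular-locally-constant character function `Θ` of an irreducible class `c`, `|D|^{1∕4}·|Θ|` is bounded on a neighbourhood of `s`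
(`s ∼ diag(α,α,β)`, `G_s = U(2)×U(1)` quasi-split or `U(1,1)×U(1)`: descent to `G_s` + the rank-one bound; = (12D-ge3) «LIE» :619 with `N := 3`: `cmDatum L 3 H`, `^ (3 - 1)`; the ONE load-bearing instance of that leaf on the `stub_StCharTS` cone; size XL). [cite: HarishChandra1999AdmissibleDistributions, Thm. 16.3 p. 77, §18 pp. 78–79] [cite: Rogawski1990, §3.8 p. 34]
ED. 1 (K2E3-typ2 g0, 2026-09-04): HOSTED LEAF — statement bytes = the cut described in the module docstring, from «LIE» tree sha16 ab77c5ccccbbc4a5 (generator `mk_lie3_ed1.py`).  OPEN (payer files `Theorems/…lean --supports stmt-HodgeConjecture-24833 --as helper`, never importing `Lines`).  ED. 2: TIED over PART «LIE3b» §B head `normalizedCharBddNearSingularDescentThree_of_sigs` (K2E3-typ4 (g0)).  STATE: TIED (open content = LIE3b (12D-3U)/(12D-3tr)/(12D-3split)). -/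
theorem sig_K2E3NormalizedCharBddNearSingularDescentThree :
    ∀ (L : Type) [Field L] [NumberField L] [IsCMField L] (H : Matrix (Fin 3) (Fin 3) L),
      (H.map (cmConjRingHom L))ᵀ = H → H.det ≠ 0 →
      ∀ (v : HeightOneSpectrum (𝓞 ↥(maximalRealSubfield L)))
        [MeasurableSpace ((UnitaryGroup.cmDatum L 3 H).Local v)] [BorelSpace ((UnitaryGroup.cmDatum L 3 H).Local v)]
        (μ : Measure ((UnitaryGroup.cmDatum L 3 H).Local v)) [μ.IsHaarMeasure]
        (c : IrrClass ((UnitaryGroup.cmDatum L 3 H).Local v)) (Θ : (UnitaryGroup.cmDatum L 3 H).Local v → ℂ),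
        LocallyIntegrable Θ μ →
        (∀ x : (UnitaryGroup.cmDatum L 3 H).Local v,
          IsRegularElt (x.val : GL (Fin 3) (UnitaryGroup.LocalRing L v)) → ∀ᶠ y in 𝓝 x, Θ y = Θ x) →
        (∀ φ : (UnitaryGroup.cmDatum L 3 H).Local v → ℂ, IsLocSmooth φ → c.smoothTrace μ φ = ∫ x, φ x * Θ x ∂μ) →
      ∀ s : (UnitaryGroup.cmDatum L 3 H).Local v, Module.End.IsSemisimple (Matrix.toLin' ((s.val : GL (Fin 3) (UnitaryGroup.LocalRing L v)).val : Matrix (Fin 3) (Fin 3) (UnitaryGroup.LocalRing L v))) →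
        ¬ IsRegularElt (s.val : GL (Fin 3) (UnitaryGroup.LocalRing L v)) → s ∉ Subgroup.center ((UnitaryGroup.cmDatum L 3 H).Local v) →
        ∃ U : Set ((UnitaryGroup.cmDatum L 3 H).Local v), IsOpen U ∧ s ∈ U ∧
        ∃ B : ℝ, ∀ g ∈ U, ∀ u : (UnitaryGroup.LocalRing L v)ˣ,
          (u : UnitaryGroup.LocalRing L v) *
              (((g.val : GL (Fin 3) (UnitaryGroup.LocalRing L v)).val : Matrix (Fin 3) (Fin 3) (UnitaryGroup.LocalRing L v)).det) ^ (3 - 1) =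
            (((g.val : GL (Fin 3) (UnitaryGroup.LocalRing L v)).val : Matrix (Fin 3) (Fin 3) (UnitaryGroup.LocalRing L v)).charpoly).discr →
          ((NNReal.sqrt (NNReal.sqrt (unitModulusChar (UnitaryGroup.LocalRing L v) u)) : ℝ≥0) : ℝ) * ‖Θ g‖ ≤ B :=
  normalizedCharBddNearSingularDescentThree_of_sigs

set_option maxHeartbeats 1600000 in
set_option synthInstance.maxHeartbeats 400000 in
open scoped Classical in
open MeasureTheory.Measure Filter Topology Polynomial Literature.NumberTheory.GaloisRepresentations.IsNonarchimedeanLocalField Summit.HodgeConjecture.HodgeConjecture.Cruxes.H413.K2E3LieUnitary in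
/-- **LEAF (12D-ge4) `sig_K2E3NormalizedCharBddNearSingularDescentGeFour`** — (12-D) FOR `N ≥ 4` (= (12D-ge3) «LIE» :619 text under `4 ≤ N`, single edit; size XL; GENERALITY: no consumer on the `stub_StCharTS` cone; count-neutral residue). [cite: HarishChandra1999AdmissibleDistributions, Thm. 16.3 p. 77, §18 pp. 78–79] [cite: Rogawski1990, §3.8 p. 34]
ED. 1 (K2E3-typ2 g0, 2026-09-04): HOSTED LEAF — statement bytes = the cut described in the module docstring, from «LIE» tree sha16 ab77c5ccccbbc4a5 (generator `mk_lie3_ed1.py`).  OPEN (payer files `Theorems/…lean --supports stmt-HodgeConjecture-24833 --as helper`, never importing `Lines`).  STATE: OPEN. -/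
theorem sig_K2E3NormalizedCharBddNearSingularDescentGeFour :
    ∀ (L : Type) [Field L] [NumberField L] [IsCMField L] (N : ℕ), 4 ≤ N → ∀ (H : Matrix (Fin N) (Fin N) L),
      (H.map (cmConjRingHom L))ᵀ = H → H.det ≠ 0 →
      ∀ (v : HeightOneSpectrum (𝓞 ↥(maximalRealSubfield L)))
        [MeasurableSpace ((UnitaryGroup.cmDatum L N H).Local v)] [BorelSpace ((UnitaryGroup.cmDatum L N H).Local v)]
        (μ : Measure ((UnitaryGroup.cmDatum L N H).Local v)) [μ.IsHaarMeasure]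
        (c : IrrClass ((UnitaryGroup.cmDatum L N H).Local v)) (Θ : (UnitaryGroup.cmDatum L N H).Local v → ℂ),
        LocallyIntegrable Θ μ →
        (∀ x : (UnitaryGroup.cmDatum L N H).Local v,
          IsRegularElt (x.val : GL (Fin N) (UnitaryGroup.LocalRing L v)) → ∀ᶠ y in 𝓝 x, Θ y = Θ x) →
        (∀ φ : (UnitaryGroup.cmDatum L N H).Local v → ℂ, IsLocSmooth φ → c.smoothTrace μ φ = ∫ x, φ x * Θ x ∂μ) →
      ∀ s : (UnitaryGroup.cmDatum L N H).Local v, Module.End.IsSemisimple (Matrix.toLin' ((s.val : GL (Fin N) (UnitaryGroup.LocalRing L v)).val : Matrix (Fin N) (Fin N) (UnitaryGroup.LocalRing L v))) →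
        ¬ IsRegularElt (s.val : GL (Fin N) (UnitaryGroup.LocalRing L v)) → s ∉ Subgroup.center ((UnitaryGroup.cmDatum L N H).Local v) →
        ∃ U : Set ((UnitaryGroup.cmDatum L N H).Local v), IsOpen U ∧ s ∈ U ∧
        ∃ B : ℝ, ∀ g ∈ U, ∀ u : (UnitaryGroup.LocalRing L v)ˣ,
          (u : UnitaryGroup.LocalRing L v) *
              (((g.val : GL (Fin N) (UnitaryGroup.LocalRing L v)).val : Matrix (Fin N) (Fin N) (UnitaryGroup.LocalRing L v)).det) ^ (N - 1) =
            (((g.val : GL (Fin N) (UnitaryGroup.LocalRing L v)).val : Matrix (Fin N) (Fin N) (UnitaryGroup.LocalRing L v)).charpoly).discr →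
          ((NNReal.sqrt (NNReal.sqrt (unitModulusChar (UnitaryGroup.LocalRing L v) u)) : ℝ≥0) : ℝ) * ‖Θ g‖ ≤ B := by
  sorry

end Summit.HodgeConjecture.HodgeConjecture.Cruxes.H413.K2E3EllipticInputs.U12Characters

end
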